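import Summits.ResolutionOfSingularities.ResolutionOfSingularities.Theorems.HilbertSamuelEliminationSigmaMaxModificationsCorridor3ConfinedStubOfT123
import Summits.ResolutionOfSingularities.ResolutionOfSingularities.Theorems.HilbertSamuelEliminationSigmaMaxModificationsCorridor3HypersurfaceChart
import Summits.ResolutionOfSingularities.ResolutionOfSingularities.Theorems.HilbertSamuelEliminationSigmaMaxModificationsCorridor3EmbeddedTower
import HarnessLib

/-!
# Route `HilbertSamuelElimination`, crux `SigmaMaxModificationsCorridor3`
# (stmt-ResolutionOfSingularities-19249; child of `SigmaMaxModifications` stmt-…-18506),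
# line `tame_wild` v3.1 (confined form) — the REGISTERED stub `stub_confinedTameNu3_of_thor4`,
# verbatim, modulo the ONE remaining brick T1 (per-chart transfer)

[OURS · L1 W4.2] The bricks T2 (hypersurface chart, `Helpers.stub_T2_hypersurfaceChart_ker`,
p482918, stub-2) and T3 (embedded tower, `Helpers.stub_T3_embeddedTower`, stub-2) of the lead's
three-brick assembly `TameWild.confinedTameNu3_of_thor4_of_T123` (p483233) are now theorems; this
file discharges them, leaving the registered signature of `stub_confinedTameNu3_of_thor4`
(skeleton tame_wild v3.1 on stmt-…-19249) conditional on the per-chart transfer T1 alone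
(hypothesis `hT1`, helpers-v3 signature verbatim; stub-4's row T1′ additionally carries
`[IsLocallyNoetherian Z]` and `ν ≠ Φ^{(3)}`, both available at the lead's call site). When T1
lands: `theorem stub_confinedTameNu3_of_thor4 := confinedTameNu3_of_thor4_of_T1 hT1`.
NOT a statement of any manuscript under review.

## Sources
* V. Cossart, U. Jannsen, S. Saito, LNM 2270 (2020), Def. 6.14, Rem. 6.24. [CossartJannsenSaito2020]
* E. Bierstone, D. Grigoriev, P. Milman, J. Włodarczyk, arXiv:1206.3090, Thm. 8.0.5.
  [BierstoneGrigorievMilmanWlodarczyk2011]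
-/

set_option linter.dupNamespace false -- mandated namespace of this single-conjunct summit

noncomputable section

open CategoryTheory AlgebraicGeometry TopologicalSpace Topology
open Literature.AlgebraicGeometry.Resolution Literature.RingTheory.HilbertSamuel

namespace Summit.ResolutionOfSingularities.ResolutionOfSingularities.Theorems.SigmaMaxModificationsCorridor3.TameWild

/-- **The registered stub `stub_confinedTameNu3_of_thor4` (v3.1), verbatim, modulo the per-chart
transfer T1 alone** (T2 = `Helpers.stub_T2_hypersurfaceChart_ker`, T3 = `Helpers.stub_T3_embeddedTower`
discharged in `confinedTameNu3_of_thor4_of_T123`). [cite: CossartJannsenSaito2020, Def. 6.14, Rem. 6.24]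
[cite: BierstoneGrigorievMilmanWlodarczyk2011, Thm. 8.0.5] -/
theorem confinedTameNu3_of_thor4_of_T1
    -- T1: per-chart transfer
    (hT1 : ∀ (k : Type) [Field k] (Y : Scheme.{0}) (g : Y ⟶ Spec (.of k))
      [LocallyOfFiniteType g] [IsReduced Y], topologicalKrullDim Y ≤ ((3 : ℕ) : WithBot ℕ∞) →
      ∀ (ν : ℕ → ℕ), Maximal (· ∈ Scheme.hsValues Y 3) ν → ∀ (m : ℕ), 1 ≤ m →
      ∀ (V : Scheme.{0}) (j : V ⟶ Y) [IsOpenImmersion j] (Z : Scheme.{0}), Scheme.IsRegular Z →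
      ∀ (I : Z.IdealSheafData), IsEffectiveCartier I → ∀ (ι : V ⟶ Z) [IsClosedImmersion ι],
      ι.ker = I →
      (⟨I, [], m⟩ : MarkedIdeal Z).support = ι.base '' Scheme.hsStratum V 3 ν →
      (∀ z : Z, idealOrder I z ≤ (m : ℕ∞)) →
      ∀ (t : CentreSeq Z), t.IsResolutionOf (⟨I, [], m⟩ : MarkedIdeal Z) →
      ∃ s : CentreSeq V, s.AllRegular ∧ s.CentresOver (Scheme.hsStratum V 3 ν) ∧
        (∀ x' : s.top, Scheme.hsFun s.top 3 x' ≤ Scheme.hsFun V 3 (s.comp.base x')) ∧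
        ν ∉ Scheme.hsValues s.top 3) :
    -- the registered signature of `stub_confinedTameNu3_of_thor4` (skeleton v3.1), verbatim
    ∀ p : ℕ, p.Prime → 5 ≤ p →
      (∀ (k : Type) [Field k] [CharP k p] [PerfectField k] (Z : Scheme.{0})
        (h : Z ⟶ Spec (.of k)), IsSeparated h → LocallyOfFiniteType h → QuasiCompact h →
        IsIntegral Z → Scheme.IsRegular Z → topologicalKrullDim Z ≤ ((4 : ℕ) : WithBot ℕ∞) →
        ∀ (I : Z.IdealSheafData), I ≠ ⊥ → IsEffectiveCartier I → ∀ m : ℕ, 1 ≤ m → m < p →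
          ∃ t : CentreSeq Z, t.IsResolutionOf (⟨I, [], m⟩ : MarkedIdeal Z)) →
      ∀ (k : Type) [Field k] [CharP k p] [PerfectField k] (Y : Scheme.{0})
        (g : Y ⟶ Spec (.of k)), IsSeparated g → LocallyOfFiniteType g → QuasiCompact g →
        IsReduced Y → ((3 : ℕ) : WithBot ℕ∞) ≤ topologicalKrullDim Y →
        topologicalKrullDim Y ≤ ((3 : ℕ) : WithBot ℕ∞) →
        ∀ ν : ℕ → ℕ, Maximal (· ∈ Scheme.hsValues Y 3) ν → ν ≠ iterPSum 3 Phi →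
          IsTameValue p ν →
          ¬ Disjoint (closure ((Scheme.regularLocus Y)ᶜ \ Scheme.hsStratum Y 3 ν))
              (Scheme.hsStratum Y 3 ν) →
          ∀ s : CentreSeq Y, s.AllRegular → s.CentresOver (Scheme.hsStratum Y 3 ν) →
            (∀ x' : s.top, Scheme.hsFun s.top 3 x' ≤ Scheme.hsFun Y 3 (s.comp.base x')) →
            ((fun x' => s.comp.base x') '' Scheme.hsStratum s.top 3 ν).Finite →
            (∀ y ∈ (fun x' => s.comp.base x') '' Scheme.hsStratum s.top 3 ν,
              IsClosed ({y} : Set Y)) →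
            NuMod Y 3 3 ν :=
  confinedTameNu3_of_thor4_of_T123 hT1 Helpers.stub_T2_hypersurfaceChart_ker
    Helpers.stub_T3_embeddedTower

end Summit.ResolutionOfSingularities.ResolutionOfSingularities.Theorems.SigmaMaxModificationsCorridor3.TameWild

end
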